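import Literature.AlgebraicGeometry.Resolution.EmbeddedLocalUniformization
import Literature.AlgebraicGeometry.Resolution.LocalUniformization
import Mathlib.RingTheory.AlgebraicIndependent.Basic
import Mathlib.RingTheory.AlgebraicIndependent.Defs
import Mathlib.Algebra.MvPolynomial.CommRing
import Mathlib.Algebra.Polynomial.Degree.TrailingDegree
import Mathlib.RingTheory.Polynomial.Basic
import Mathlib.FieldTheory.IsAlgClosed.Basic
import Mathlib.Algebra.CharP.Defs
import HarnessLib

/-!
# Local reduction of multiplicity in dimension `m` and the Cutkosky–Mourtada ladder
# (Cutkosky–Mourtada 2019, Defs. 1.1, 1.3 and statements (1), (2))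

Topic: `Literature/AlgebraicGeometry/Resolution` (local uniformization of valued function
fields). Companion of `EmbeddedLocalUniformization.lean` (`ELU k m`, `ELUInDim m`, `elu_one`).
S. D. Cutkosky, H. Mourtada, *Defect and local uniformization*, RACSAM 113 (2019) 4211–4226
= arXiv:1711.02726, §1, verbatim:

> **Definition 1.1.** Local uniformization holds in dimension `m` (LU holds in dimension `m`)
> if for every algebraic function field `K` over an algebraically closed field `k` of dimension
> `m` and for every valuation `ν` of `K/k`, there exists an algebraic local ring `R` of `K` such
> that `R` is regular and `ν` dominates `R`.

> **Definition 1.3.** Local reduction of multiplicity holds in dimension `m` (LRM holds in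
> dimension `m`) if the following is true: Suppose that `A = k[x₁,…,x_m,x_{m+1}]` is a polynomial
> ring in `m+1` variables over an algebraically closed field `k`, `f ∈ A` is irreducible and `K`
> is the quotient field of `A/(f)`, with `f ∈ 𝔪 = (x₁,…,x_{m+1})` and
> `r = ord(f(0,…,0,x_{m+1}))` satisfies `1 < r < ∞`. Suppose that `ν` is a zero dimensional
> valuation of the quotient field of `A/(f)` which dominates `(A/(f))_𝔪`. Then there exists a
> birational extension `A → A₁` where `A₁` is a polynomial ring `A₁ = k[x₁(1),…,x_{m+1}(1)]`
> such that `ν` dominates `(A₁/f₁)_{𝔪₁}` where `f₁` is a strict transform of `f` in `A₁`,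
> `𝔪₁ = (x₁(1),…,x_{m+1}(1))`, and `1 ≤ r₁ = ord(f₁(0,…,0,x_{m+1}(1))) < r`.

> Now ELU in dimension `m` immediately implies LU in dimension `m−1` for hypersurfaces, which
> implies LU in dimension `m−1` by the primitive element theorem. Consider the following
> statements: **(1)** LRM in dimension `m` implies ELU in dimension `m+1`. **(2)** ELU in
> dimension `m` implies LRM in dimension `m`. If statements (1) and (2) are true, then we could
> immediately deduce that ELU in dimension `m` implies ELU in dimension `m+1`, and we would then
> know that LU holds in all dimensions. … The proofs of resolution in dimension three and
> positive characteristic cited above involve tricks to obtain a proof that ELU in dimension 3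
> and LRM in dimension 3 in the special case `r = p = char k` implies LU in dimension 3. The
> problem is that we do not know ELU in dimension 4, so we are unable to proceed to LU in
> dimension 4. Now (1) is not so difficult. … So the really hard thing that needs to be proven
> (to obtain LU) is (2).

with, loc. cit. §1–§2: "An algebraic local ring `R` of a function field `K/k` is a local domain
which is essentially of finite type over `k` with quotient field `K`. A valuation `ν` of an
algebraic function field `K/k` is required to be trivial on `k`. … `ν` dominates `R` if
`R ⊂ V_ν` … and `m_ν ∩ R = m_R`"; "zero dimensional if the transcendence degree of the residue
field of the valuation ring of `ν` over `k` is zero"; "An inclusion `A → B` of domains is said to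
be a birational extension if `A` and `B` have the same quotient field and `B` is essentially of
finite type over `A`" (§2); and §4/§6 for the strict transform: "`f = x₁(1)^{c₁}⋯x_m(1)^{c_m} f₁`
where `f₁ ∈ k[x₁(1),…,x_m(1)]` is irreducible. The ring `k[x₁(1),…,x_m(1)]/(f₁)` is … a
birational transformation of … `k[x₁,…,x_m]/(f)`", "if `f′` is the strict transform of `f` in
`T′`, so that `S′ = T′/(f′)` is a birational extension `S → S′` along `ν*`" (Thm. 6.1).
[CutkoskyMourtada2019]

Written for the dimension-`4` census of the cell `pub-hironaka` (unit `b2b-hironaka-cp4`,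
`OBSTRUCTIONS-DIM4.md` rows O1 and O4): the local form of the open input O1 is `ELUInDim 4`
(companion module); Cossart–Piltant's hard theorem is, in this vocabulary, "LRM in dimension
`3` in the special case `r = p`" (`LRMOfOrderInDim 3 p` over algebraically closed fields of
characteristic `p`, as the source phrases it), and the local form of the open input O4 is
`LRMOfOrderInDim 4 p`.

## Content

* `axisRestriction m` — `f ↦ f(0,…,0,x_{m+1})`, the `k`-algebra map
  `k[x₁,…,x_{m+1}] → k[X]` killing `x₁,…,x_m`; `ord` of the result at `0` is its
  `natTrailingDegree` (for a nonzero polynomial).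
* `LRMOfOrder k m r` — Def. 1.3 for the germs with `ord f(0,…,0,x_{m+1}) = r`, `1 < r` (so that
  "the special case `r = p`" has a name; vacuous for `r ≤ 1`); `LRM k m` — Def. 1.3 (all
  `1 < r < ∞`); `LRMInDim m`, `LRMOfOrderInDim m r` — over every algebraically closed field.
* `LUInDim m` — Def. 1.1, over the tree's `IsLocallyUniformizable`.
* `CutkoskyMourtada.Statement1 m`, `CutkoskyMourtada.Statement2 m` — the statements (1), (2)
  as predicates (asserted nowhere; (2) is "the really hard thing", (1) "not so difficult" — both
  unproved in print for `k` of positive characteristic and `m ≥ 3`, loc. cit.).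
* PROVED (bookkeeping only, no mathematics of the source is reproduced):
  `lrm_iff_forall_lrmOfOrder`; the ladder `eluInDim_of_statements` (from the companion's
  `elu_one`: (1) and (2) for all `m ≥ 1` give ELU in every dimension `≥ 1`);
  `eluInDim_four_of_rungs` (exactly the six rungs below dimension `4`);
  `eluInDim_four_of_lrmInDim_three` (the dimension-`4` rung isolated: `ELUInDim 4` follows from
  LRM in dimension `3` FOR ALL `r` and statement (1) at `m = 3`);
  `luInDim_of_localUniformizationInChar` (the tree's `LocalUniformizationInChar p` for every
  `p` gives Def. 1.1 in every dimension).

## Rendering notes (as in the companion module)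

* `A = k[x₁,…,x_{m+1}]`, `Frac A` ↦ a field `E ⊇ k` with an algebraically independent
  `x : Fin (m+1) → E` and `IsFractionRing k[x] E`; `f ∈ A` ↦ `f = aeval x P` for a
  `P : MvPolynomial (Fin (m+1)) k` (`k[x] ≅ MvPolynomial` by `AlgebraicIndependent.aevalEquiv`,
  so `Irreducible P` is "`f` irreducible"); `f ∈ 𝔪` ↦ `constantCoeff P = 0`;
  `r = ord f(0,…,0,x_{m+1})`, `1 < r < ∞` ↦ `axisRestriction m P ≠ 0` and
  `1 < natTrailingDegree`.
* "`K` is the quotient field of `A/(f)`, `ν` a valuation of `K`" ↦ a field `K ⊇ k`, a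
  `k`-algebra map `φ : k[x] → K` with kernel `(f)` and `Frac (range φ) = K`, and a valuation ring
  `O ⊇ k` of `K`; "`ν` dominates `(A/(f))_𝔪`" ↦ `φ(x i) ∈ O` and `ν(φ(x i)) < 1` for all `i`
  (then `𝔪 ⊆ m_ν ∩ (A/(f)) ⊊ A/(f)`, so the centre is `𝔪`); "zero dimensional" (for `k = k̄`) ↦
  every element of `O` is congruent to a constant modulo `m_ν`.
* The conclusion "birational extension `A → A₁ = k[x₁(1),…,x_{m+1}(1)]`, `ν` dominates
  `(A₁/f₁)_{𝔪₁}`, `f₁` a strict transform of `f`" ↦ a second algebraically independent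
  `x₁ : Fin (m+1) → E` with `k[x] ⊆ k[x₁]` (same fraction field `E`, finitely generated), a
  `P₁` with `f₁ = aeval x₁ P₁`, and a `k`-algebra map `φ₁ : k[x₁] → K` EXTENDING `φ` with kernel
  `(f₁)` — i.e. `S = A/(f) ⊆ S′ = A₁/(f₁) ⊆ K = Frac S`, the printed "birational extension
  `S → S′` along `ν*`" — with `φ₁(x₁ i) ∈ O`, `ν(φ₁(x₁ i)) < 1`.
* `Irreducible P` is implied by "kernel `(f)` is a prime" and is kept because it is printed.
* Nothing is asserted: all `def`s below are predicates; `LRMInDim m` (`m ≥ 3`, general `r`),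
  `ELUInDim 4`, `Statement1 m`, `Statement2 m` are open in print.
-/

noncomputable section

open Polynomial

namespace Literature.AlgebraicGeometry.Resolution

universe u

variable {k : Type u} [Field k]

/-- **Restriction to the last axis**: the `k`-algebra map `k[x₁,…,x_{m+1}] → k[X]`,
`x_i ↦ 0` (`i ≤ m`), `x_{m+1} ↦ X`, i.e. `f ↦ f(0,…,0,x_{m+1})` of Cutkosky–Mourtada 2019,
Def. 1.3. [cite: CutkoskyMourtada2019, §1 Def. 1.3] -/
def axisRestriction (k : Type u) [Field k] (m : ℕ) : MvPolynomial (Fin (m + 1)) k →ₐ[k] k[X] :=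
  MvPolynomial.aeval fun i => if i = Fin.last m then X else 0

/-- `axisRestriction` on variables: the last variable goes to `X`, the others to `0`.
[folklore] -/
@[simp] theorem axisRestriction_X (m : ℕ) (i : Fin (m + 1)) :
    axisRestriction k m (MvPolynomial.X i) = if i = Fin.last m then X else 0 := by
  simp [axisRestriction]

/-- **Local reduction of multiplicity in dimension `m` over `k`, for germs of axis order `r`**
(Cutkosky–Mourtada 2019, Def. 1.3 with `ord f(0,…,0,x_{m+1}) = r` fixed; renderings in the
module docstring). For every polynomial ring `k[x] = k[x₁,…,x_{m+1}] ⊆ E = Frac k[x]`, every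
irreducible `f = P(x) ∈ (x₁,…,x_{m+1})` with `f(0,…,0,x_{m+1})` of order exactly `r`, every
hypersurface function field `K = Frac(k[x]/(f))` (presented by `φ : k[x] → K` with kernel `(f)`)
and every valuation ring `O ⊇ k` of `K` with constant residues dominating the origin: there are a
birational extension of polynomial rings `k[x] ⊆ k[x₁]` inside `E`, a strict transform
`f₁ = P₁(x₁)` — `φ` extends to `φ₁ : k[x₁] → K` with kernel `(f₁)` — such that `O` dominates the
origin of `k[x₁]/(f₁)` and `1 ≤ ord f₁(0,…,0,x_{m+1}(1)) < r`. A predicate, asserted nowhere.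
[cite: CutkoskyMourtada2019, §1 Def. 1.3] -/
def LRMOfOrder (k : Type u) [Field k] (m r : ℕ) : Prop :=
  1 < r → ∀ (E : Type u) [Field E] [Algebra k E] (x : Fin (m + 1) → E),
    AlgebraicIndependent k x → IsFractionRing (Algebra.adjoin k (Set.range x)) E →
  ∀ (P : MvPolynomial (Fin (m + 1)) k), Irreducible P → MvPolynomial.constantCoeff P = 0 →
    axisRestriction k m P ≠ 0 → (axisRestriction k m P).natTrailingDegree = r →
  ∀ (K : Type u) [Field K] [Algebra k K] (φ : Algebra.adjoin k (Set.range x) →ₐ[k] K),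
    (∀ g : Algebra.adjoin k (Set.range x),
        φ g = 0 ↔ ∃ h : Algebra.adjoin k (Set.range x), (g : E) = (h : E) * MvPolynomial.aeval x P) →
    IsFractionRing φ.range K →
  ∀ (O : ValuationSubring K), (∀ c : k, algebraMap k K c ∈ O) →
    (∀ y : K, y ∈ O → ∃ c : k, O.valuation (y - algebraMap k K c) < 1) →
    (∀ i, φ ⟨x i, Algebra.subset_adjoin (Set.mem_range_self i)⟩ ∈ O) →
    (∀ i, O.valuation (φ ⟨x i, Algebra.subset_adjoin (Set.mem_range_self i)⟩) < 1) →
  ∃ (x₁ : Fin (m + 1) → E) (_ : AlgebraicIndependent k x₁)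
    (hle : Algebra.adjoin k (Set.range x) ≤ Algebra.adjoin k (Set.range x₁))
    (P₁ : MvPolynomial (Fin (m + 1)) k) (φ₁ : Algebra.adjoin k (Set.range x₁) →ₐ[k] K),
    φ₁.comp (Subalgebra.inclusion hle) = φ ∧
    (∀ g : Algebra.adjoin k (Set.range x₁),
        φ₁ g = 0 ↔ ∃ h : Algebra.adjoin k (Set.range x₁), (g : E) = (h : E) * MvPolynomial.aeval x₁ P₁) ∧
    (∀ i, φ₁ ⟨x₁ i, Algebra.subset_adjoin (Set.mem_range_self i)⟩ ∈ O) ∧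
    (∀ i, O.valuation (φ₁ ⟨x₁ i, Algebra.subset_adjoin (Set.mem_range_self i)⟩) < 1) ∧
    axisRestriction k m P₁ ≠ 0 ∧ 1 ≤ (axisRestriction k m P₁).natTrailingDegree ∧
      (axisRestriction k m P₁).natTrailingDegree < r

/-- **Local reduction of multiplicity in dimension `m` over `k`** (Cutkosky–Mourtada 2019,
Def. 1.3: all germs with `1 < r = ord f(0,…,0,x_{m+1}) < ∞`). [cite: CutkoskyMourtada2019, §1 Def. 1.3] -/
def LRM (k : Type u) [Field k] (m : ℕ) : Prop :=
  ∀ r : ℕ, LRMOfOrder k m r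

/-- **"LRM holds in dimension `m`"** (Cutkosky–Mourtada 2019, Def. 1.3): `LRM k m` for every
algebraically closed field `k`. Open in print for `m ≥ 3` and general `r` in positive
characteristic (§1: "the really hard thing that needs to be proven (to obtain LU) is (2)",
i.e. `ELUInDim m → LRMInDim m`). [cite: CutkoskyMourtada2019, §1 Def. 1.3] -/
def LRMInDim (m : ℕ) : Prop :=
  ∀ (k : Type u) [Field k] [IsAlgClosed k], LRM k m

/-- **"LRM in dimension `m` in the special case `ord = r`"** over every algebraically closed
field — the source's phrase for Cossart–Piltant's theorem is `m = 3`, `r = p = char k`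
(§1: "ELU in dimension 3 and LRM in dimension 3 in the special case `r = p = char k` implies LU
in dimension 3"); the dimension-`4` census input O4 (local form) is `m = 4`, `r = p`.
[cite: CutkoskyMourtada2019, §1 (discussion after Def. 1.3)] -/
def LRMOfOrderInDim (m r : ℕ) : Prop :=
  ∀ (k : Type u) [Field k] [IsAlgClosed k], LRMOfOrder k m r

/-- **"LU holds in dimension `m`"** (Cutkosky–Mourtada 2019, Def. 1.1), over the tree's weak
local uniformization predicate `IsLocallyUniformizable` (a finitely generated `k`-subalgebra
`A ⊆ V_ν` with `Frac A = K`, regular at the centre — i.e. a regular algebraic local ring of `K`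
dominated by `ν`): for every algebraically closed `k`, every finitely generated field extension
`K/k` of transcendence degree `m` and every valuation ring `O ⊇ k` of `K`. Asserted nowhere;
open for `m ≥ 4` in positive characteristic. [cite: CutkoskyMourtada2019, §1 Def. 1.1] -/
def LUInDim (m : ℕ) : Prop :=
  ∀ (k K : Type u) [Field k] [IsAlgClosed k] [Field K] [Algebra k K],
    (⊤ : IntermediateField k K).FG → Algebra.trdeg k K = m →
    ∀ O : ValuationSubring K, (∀ c : k, algebraMap k K c ∈ O) → IsLocallyUniformizable k K O

namespace CutkoskyMourtada

/-- **Statement (1)** of Cutkosky–Mourtada 2019, §1: "LRM in dimension `m` implies ELU in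
dimension `m+1`" — a predicate ("(1) is not so difficult. In fact, induction on `r` in LRM in
dimension `m` almost gives ELU in dimension `m+1`"; no proof is printed). Asserted nowhere.
[cite: CutkoskyMourtada2019, §1 statement (1)] -/
def Statement1 (m : ℕ) : Prop :=
  LRMInDim.{u} m → ELUInDim.{u} (m + 1)

/-- **Statement (2)** of Cutkosky–Mourtada 2019, §1: "ELU in dimension `m` implies LRM in
dimension `m`" — "the really hard thing that needs to be proven (to obtain LU)"; proved there
only when a defectless finite linear projection exists (Thms. 1.4, 6.1, 7.1). Asserted nowhere.
[cite: CutkoskyMourtada2019, §1 statement (2)] -/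
def Statement2 (m : ℕ) : Prop :=
  ELUInDim.{u} m → LRMInDim.{u} m

end CutkoskyMourtada

/-! ## Bookkeeping (proved): `LRM` versus `LRMOfOrder`, and the ladder -/

/-- `LRM k m` is `LRMOfOrder k m r` for every `r` (the case `r ≤ 1` is excluded inside
`LRMOfOrder`, as in the source: `1 < r < ∞`). [folklore] -/
theorem lrm_iff_forall_lrmOfOrder (k : Type u) [Field k] (m : ℕ) :
    LRM k m ↔ ∀ r : ℕ, LRMOfOrder k m r :=
  Iff.rfl

/-- `LRMOfOrder k m r` is vacuous for `r ≤ 1` (Def. 1.3 requires `1 < r`). [folklore] -/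
theorem lrmOfOrder_of_le_one (k : Type u) [Field k] (m : ℕ) {r : ℕ} (hr : r ≤ 1) :
    LRMOfOrder k m r :=
  fun h => absurd h (not_lt.mpr hr)

/-- `LRMInDim m` gives each special case `LRMOfOrderInDim m r`. [folklore] -/
theorem LRMInDim.lrmOfOrderInDim {m : ℕ} (h : LRMInDim.{u} m) (r : ℕ) :
    LRMOfOrderInDim.{u} m r :=
  fun k _ _ => h k r

/-- Conversely the special cases for all `r` (equivalently all `r > 1`) give `LRMInDim m`.
[folklore] -/
theorem lrmInDim_of_forall_lrmOfOrderInDim {m : ℕ}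
    (h : ∀ r : ℕ, 1 < r → LRMOfOrderInDim.{u} m r) : LRMInDim.{u} m :=
  fun k _ _ r hr => h r hr k hr

/-- **ELU holds in dimension `1`** in the sense of `ELUInDim` (from the companion module's
`elu_one`, valid over every field). [folklore] -/
theorem eluInDim_one : ELUInDim.{u} 1 :=
  fun k _ _ => elu_one k

/-- **One step of the ladder**: statements (2) at `m` and (1) at `m` turn ELU in dimension `m`
into ELU in dimension `m + 1` ("we could immediately deduce that ELU in dimension `m` implies
ELU in dimension `m+1`"). [cite: CutkoskyMourtada2019, §1 (after statements (1), (2))] -/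
theorem eluInDim_succ_of_statements {m : ℕ} (h2 : CutkoskyMourtada.Statement2.{u} m)
    (h1 : CutkoskyMourtada.Statement1.{u} m) (h : ELUInDim.{u} m) : ELUInDim.{u} (m + 1) :=
  h1 (h2 h)

/-- **The Cutkosky–Mourtada ladder**: if statements (1) and (2) hold in every dimension
`m ≥ 1`, then ELU holds in every dimension `m ≥ 1` (base: `eluInDim_one`). The source adds
"and we would then know that LU holds in all dimensions" via "ELU in dimension `m` immediately
implies LU in dimension `m−1`", which is not reproduced here.
[cite: CutkoskyMourtada2019, §1 (after statements (1), (2))] -/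
theorem eluInDim_of_statements
    (h1 : ∀ m : ℕ, 1 ≤ m → CutkoskyMourtada.Statement1.{u} m)
    (h2 : ∀ m : ℕ, 1 ≤ m → CutkoskyMourtada.Statement2.{u} m) :
    ∀ m : ℕ, 1 ≤ m → ELUInDim.{u} m := by
  intro m hm
  induction m with
  | zero => exact absurd hm (Nat.not_succ_le_zero 0)
  | succ n ih =>
    rcases Nat.eq_zero_or_pos n with rfl | hn
    · exact eluInDim_one
    · exact eluInDim_succ_of_statements (h2 n hn) (h1 n hn) (ih hn)

/-- Under (1) and (2) in every dimension `≥ 1`, LRM also holds in every dimension `≥ 1`.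
[cite: CutkoskyMourtada2019, §1 (after statements (1), (2))] -/
theorem lrmInDim_of_statements
    (h1 : ∀ m : ℕ, 1 ≤ m → CutkoskyMourtada.Statement1.{u} m)
    (h2 : ∀ m : ℕ, 1 ≤ m → CutkoskyMourtada.Statement2.{u} m) :
    ∀ m : ℕ, 1 ≤ m → LRMInDim.{u} m :=
  fun m hm => h2 m hm (eluInDim_of_statements h1 h2 m hm)

/-- **The six rungs below dimension `4`**: ELU in dimension `4` — the local form of the
dimension-`4` census input O1 — follows from statements (2) and (1) at `m = 1, 2, 3` (and the
proved `eluInDim_one`). [cite: CutkoskyMourtada2019, §1 ("we do not know ELU in dimension 4")] -/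
theorem eluInDim_four_of_rungs
    (h21 : CutkoskyMourtada.Statement2.{u} 1) (h11 : CutkoskyMourtada.Statement1.{u} 1)
    (h22 : CutkoskyMourtada.Statement2.{u} 2) (h12 : CutkoskyMourtada.Statement1.{u} 2)
    (h23 : CutkoskyMourtada.Statement2.{u} 3) (h13 : CutkoskyMourtada.Statement1.{u} 3) :
    ELUInDim.{u} 4 :=
  eluInDim_succ_of_statements h23 h13
    (eluInDim_succ_of_statements h22 h12 (eluInDim_succ_of_statements h21 h11 eluInDim_one))

/-- **The dimension-`4` rung isolated**: ELU in dimension `4` follows from LRM in dimension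
`3` — for ALL axis orders `r > 1`, not only the case `r = p` proved by Cossart–Piltant — and
statement (1) at `m = 3`. [cite: CutkoskyMourtada2019, §1 (statement (1); "we do not know ELU in dimension 4")] -/
theorem eluInDim_four_of_lrmInDim_three (hL : LRMInDim.{u} 3)
    (h13 : CutkoskyMourtada.Statement1.{u} 3) : ELUInDim.{u} 4 :=
  h13 hL

/-- LRM in dimension `3` for all `r` follows from statement (2) at `m = 3` and ELU in dimension
`3`. [cite: CutkoskyMourtada2019, §1 (statement (2))] -/
theorem lrmInDim_three_of_statement2 (h23 : CutkoskyMourtada.Statement2.{u} 3)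
    (hE : ELUInDim.{u} 3) : LRMInDim.{u} 3 :=
  h23 hE

/-- **Compatibility with the tree's local uniformization predicate**: local uniformization in
every characteristic (`LocalUniformizationInChar p` for all `p`, file `LocalUniformization.lean`)
gives "LU holds in dimension `m`" of Def. 1.1 for every `m` (specialise to algebraically closed
ground fields; the transcendence degree plays no role). [folklore] -/
theorem luInDim_of_localUniformizationInChar
    (h : ∀ p : ℕ, LocalUniformizationInChar.{u} p) (m : ℕ) : LUInDim.{u} m := by
  intro k K _ _ _ _ hfg _ O hk
  exact h (ringChar k) k K hfg O hk

end Literature.AlgebraicGeometry.Resolution
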